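import Literature.Probability.Percolation.ArmSeparationReroute
import HarnessLib

/-!
# Rotating the annulus: every arm lands on side `0` of some rotated frame

Topic: Probability / Percolation; family `crit-perc`. Symmetry bookkeeping for the separation
argument on the hexagonal annuli `Λ_{2M} ∖ Λ_n` (Nolin 2008, §4.4: "each of the `j` arms induces
in `S_{2^{K-1},2^K}` a crossing of one of the four U-shaped regions" — here one of the SIX
trapezoids behind the sides of the hexagon `∂Λ_{2M}`, all images of the trapezoid `trapD M`
behind side `0` under the rotations `ρ^i`, `ρ = triRotIso`, of `𝕋`). Rather than six trapezoids
we rotate the configuration: `rotConfig i ω = {v | ρ^i v ∈ ω}` is `ω` read in the frame in which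
side `i` becomes side `0`.

* `rotConfig i ω`, `mem_rotConfig`, `rotConfig_compl`; paths of the annulus `{n ≤ |v| ≤ N}` are
  carried back and forth (`pathIn_rotConfig`, `pathIn_of_rotConfig`; the graph norm is
  rotation invariant, `triNorm_rot_symm`); `P_{1/2}` is rotation invariant
  (`real_preimage_rotConfig`) and locality is transported (`determinedBy_preimage_rotConfig`).
* `exists_rot_symm_apply_zero_eq` — every site `y` lies on side `0` of some rotated frame:
  `((ρ^i)⁻¹ y)₀ = |y|` for some `i < 6` (the six linear forms whose maximum is `triNorm`).
* `exists_trapO_pathIn_rotConfig` — **an arm lands on side `0` of some rotated frame**: from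
  `ω ∈ armEvent ![b] n (2M)` (`n ≤ 2M`), in some `rotConfig i ω` there is a colour-`b` path of the
  annulus from a site of norm `n` to a site of `trapO M` — the input format of `trap_reroute`
  (`ArmSeparationReroute.lean`).

## References

* P. Nolin, *Near-critical percolation in two dimensions*, Electron. J. Probab. 13 (2008), §4.4
  [arXiv 0711.4948: proof of Thm. 10]. [Nolin2008]
* W. Werner, *Lectures on two-dimensional critical percolation* (2009), §1 (symmetries of `𝕋`). [Werner2009]

Tree: `triRotIsoPow`, `triRot60`, `triRotNeg60` and their coordinate lemmas
(`TriAnnulusCircuit.lean`, `TriangularLattice.lean`), `SiteConfig.relabel`, `mem_relabel_iff`,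
`sitePercolation_real_preimage_relabel` (`SitePercolationMeasure.lean`),
`determinedBy_preimage_relabel`, `SiteConfig.compl_relabel` (`TriShiftedCrossings.lean`),
`pathIn_map_iso` (`TriRSWChaining.lean`), `mem_armEvent_one_iff_exists_pathIn`
(`ArmEventsAPriori.lean`). The norm invariance `triNorm (triRot60 z) = triNorm z` is also in
`OneArmBoundaryArms.lean` (`triNorm_triRot60`); it is re-derived here for the inverse rotation in
three lines rather than importing that module, which would pull the near-critical cone
(`NearCriticalScaling`) into the arm-separation files.
-/

noncomputable section

open MeasureTheory Set

namespace Literature.Probability.Percolation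

open LatticeModels

/-! ### Rotated configurations -/

/-- **The configuration read in the `i`-th rotated frame**: `rotConfig i ω = {v | ρ^i v ∈ ω}`,
`ρ` the rotation by `60°` (`triRotIso`); side `i` of every hexagon `∂Λ_N` becomes side `0`. [cite: Nolin2008, §4.4 (arXiv 0711.4948: proof of Thm. 10)] -/
def rotConfig (i : ℕ) (ω : SiteConfig (Site 2)) : SiteConfig (Site 2) :=
  SiteConfig.relabel (triRotIsoPow i).symm.toEquiv ω

/-- Membership in the rotated configuration. [folklore] -/
@[simp] theorem mem_rotConfig {i : ℕ} {ω : SiteConfig (Site 2)} {v : Site 2} :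
    v ∈ rotConfig i ω ↔ triRotIsoPow i v ∈ ω := by
  rw [rotConfig, SiteConfig.mem_relabel_iff]; rfl

/-- Rotation commutes with colour exchange. [folklore] -/
theorem rotConfig_compl (i : ℕ) (ω : SiteConfig (Site 2)) : (rotConfig i ω)ᶜ = rotConfig i ωᶜ :=
  SiteConfig.compl_relabel _ ω

/-- The inverse rotation preserves the graph norm. [folklore] -/
theorem triNorm_triRotNeg60' (z : Site 2) : triNorm (triRotNeg60 z) = triNorm z := by
  rw [triNorm_eq_max, triNorm_eq_max]
  simp only [triRotNeg60_apply_zero, triRotNeg60_apply_one]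
  omega

/-- The inverse rotations `(ρ^i)⁻¹` preserve the graph norm. [folklore] -/
theorem triNorm_rot_symm (i : ℕ) (z : Site 2) : triNorm ((triRotIsoPow i).symm z) = triNorm z := by
  induction i generalizing z with
  | zero => rfl
  | succ i ih => rw [triRotIsoPow_succ_symm_apply, ih, triNorm_triRotNeg60']

/-- The rotations `ρ^i` preserve the graph norm. [folklore] -/
theorem triNorm_rot (i : ℕ) (z : Site 2) : triNorm (triRotIsoPow i z) = triNorm z := by
  conv_rhs => rw [← (triRotIsoPow i).symm_apply_apply z]
  rw [triNorm_rot_symm]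

/-- **Paths of the annulus in the rotated frame**: a path of colour `b` inside `{n ≤ |v| ≤ N}`
is carried by `(ρ^i)⁻¹` to a path of colour `b` of `rotConfig i ω` inside the same annulus. [folklore] -/
theorem pathIn_rotConfig (i : ℕ) {n N : ℕ} {ω : SiteConfig (Site 2)} {b : Bool} {x y : Site 2}
    (h : PathIn triGraph (triAnnSet n N ∩ {v | v ∈ ω ↔ b}) x y) :
    PathIn triGraph (triAnnSet n N ∩ {v | v ∈ rotConfig i ω ↔ b}) ((triRotIsoPow i).symm x) ((triRotIsoPow i).symm y) := by
  refine (pathIn_map_iso (triRotIsoPow i).symm h).mono ?_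
  rintro w ⟨v, ⟨hv, hvω⟩, rfl⟩
  refine ⟨?_, ?_⟩
  · rw [mem_triAnnSet] at hv ⊢
    rw [show ((triRotIsoPow i).symm : triGraph ≃g triGraph) v = (triRotIsoPow i).symm v from rfl, triNorm_rot_symm]
    exact hv
  · simp only [Set.mem_setOf_eq, mem_rotConfig] at hvω ⊢
    rw [show ((triRotIsoPow i).symm : triGraph ≃g triGraph) v = (triRotIsoPow i).symm v from rfl,
      RelIso.apply_symm_apply]
    exact hvω

/-- **Back to the original frame**: a path of colour `b` of `rotConfig i ω` inside a set `A` is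
carried by `ρ^i` to a path of colour `b` of `ω` inside `ρ^i(A)`. [folklore] -/
theorem pathIn_of_rotConfig (i : ℕ) {A : Set (Site 2)} {ω : SiteConfig (Site 2)} {b : Bool} {x y : Site 2}
    (h : PathIn triGraph (A ∩ {v | v ∈ rotConfig i ω ↔ b}) x y) :
    PathIn triGraph ((triRotIsoPow i '' A) ∩ {v | v ∈ ω ↔ b}) (triRotIsoPow i x) (triRotIsoPow i y) := by
  refine (pathIn_map_iso (triRotIsoPow i) h).mono ?_
  rintro w ⟨v, ⟨hv, hvω⟩, rfl⟩
  refine ⟨⟨v, hv, rfl⟩, ?_⟩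
  simp only [Set.mem_setOf_eq, mem_rotConfig] at hvω ⊢
  exact hvω

/-- **`P_{1/2}` (indeed every `P_p`) is rotation invariant.** [folklore] -/
theorem real_preimage_rotConfig (p : unitInterval) (i : ℕ) (E : Set (SiteConfig (Site 2))) :
    (triSitePercolation p).real (rotConfig i ⁻¹' E) = (triSitePercolation p).real E := by
  unfold triSitePercolation
  exact sitePercolation_real_preimage_relabel _ p E

/-- **Locality is transported**: if `E` is determined by `F` then `rotConfig i ⁻¹' E` is determined
by `ρ^i(F)`. [folklore] -/
theorem determinedBy_preimage_rotConfig (i : ℕ) {E : Set (SiteConfig (Site 2))} {F : Set (Site 2)}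
    (hE : DeterminedBy E F) : DeterminedBy (rotConfig i ⁻¹' E) (triRotIsoPow i '' F) := by
  have h := determinedBy_preimage_relabel (triRotIsoPow i).symm.toEquiv hE
  have hF : ((triRotIsoPow i).symm.toEquiv.symm '' F) = triRotIsoPow i '' F := by
    ext w; simp only [Set.mem_image]; rfl
  rw [hF] at h
  exact h

/-! ### Every site lies on side `0` of some rotated frame -/

/-- The inverse rotations in coordinates: `(ρ^i)⁻¹`, `i < 6`, applied to `y` has first coordinate
one of the six linear forms `y₀, y₀+y₁, y₁, -y₀, -(y₀+y₁), -y₁` whose maximum is `|y|_𝕋`. [folklore] -/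
theorem rot_symm_apply_formula (y : Site 2) :
    ((triRotIsoPow 0).symm y) 0 = y 0 ∧ ((triRotIsoPow 1).symm y) 0 = y 0 + y 1 ∧
      ((triRotIsoPow 2).symm y) 0 = y 1 ∧ ((triRotIsoPow 3).symm y) 0 = -y 0 ∧
      ((triRotIsoPow 4).symm y) 0 = -(y 0 + y 1) ∧ ((triRotIsoPow 5).symm y) 0 = -y 1 := by
  refine ⟨?_, ?_, ?_, ?_, ?_, ?_⟩ <;>
    simp only [triRotIsoPow_succ_symm_apply', triRotIsoPow_zero_symm_apply, triRotNeg60_apply_zero,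
      triRotNeg60_apply_one] <;> ring

/-- The rotations in coordinates: `ρ^i y` for `i < 6`. [folklore] -/
theorem rot_apply_formula (y : Site 2) :
    (triRotIsoPow 0 y) 0 = y 0 ∧ (triRotIsoPow 0 y) 1 = y 1 ∧
    (triRotIsoPow 1 y) 0 = -y 1 ∧ (triRotIsoPow 1 y) 1 = y 0 + y 1 ∧
    (triRotIsoPow 2 y) 0 = -(y 0 + y 1) ∧ (triRotIsoPow 2 y) 1 = y 0 ∧
    (triRotIsoPow 3 y) 0 = -y 0 ∧ (triRotIsoPow 3 y) 1 = -y 1 ∧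
    (triRotIsoPow 4 y) 0 = y 1 ∧ (triRotIsoPow 4 y) 1 = -(y 0 + y 1) ∧
    (triRotIsoPow 5 y) 0 = y 0 + y 1 ∧ (triRotIsoPow 5 y) 1 = -y 0 := by
  refine ⟨?_, ?_, ?_, ?_, ?_, ?_, ?_, ?_, ?_, ?_, ?_, ?_⟩ <;>
    simp only [triRotIsoPow_succ_apply, triRotIsoPow_zero_apply, triRot60_apply_zero, triRot60_apply_one] <;> ring

/-- `ρ^{a+b} = ρ^b ∘ ρ^a`. [folklore] -/
theorem triRotIsoPow_add_apply (a b : ℕ) (x : Site 2) : triRotIsoPow (a + b) x = triRotIsoPow b (triRotIsoPow a x) := by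
  induction b with
  | zero => rfl
  | succ b ih => rw [← Nat.add_assoc, triRotIsoPow_succ_apply, ih, triRotIsoPow_succ_apply]

/-- `ρ^{i + 6} = ρ^i`. [folklore] -/
theorem triRotIsoPow_add_six_apply (i : ℕ) (x : Site 2) : triRotIsoPow (i + 6) x = triRotIsoPow i x := by
  rw [triRotIsoPow_add_apply, triRotIsoPow_six_apply]

/-- `ρ^{i + 6q} = ρ^i`. [folklore] -/
theorem triRotIsoPow_add_six_mul_apply (i q : ℕ) (x : Site 2) : triRotIsoPow (i + 6 * q) x = triRotIsoPow i x := by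
  induction q with
  | zero => rfl
  | succ q ih => rw [Nat.mul_succ, ← Nat.add_assoc, triRotIsoPow_add_six_apply, ih]

/-- The rotations as functions of the exponent modulo `6`. [folklore] -/
theorem triRotIsoPow_mod_six_apply (d : ℕ) (x : Site 2) : triRotIsoPow (d % 6) x = triRotIsoPow d x := by
  conv_rhs => rw [← Nat.mod_add_div d 6, triRotIsoPow_add_six_mul_apply]

/-- Iterated rotated frames: `rotConfig (a + b) ω = rotConfig a (rotConfig b ω)`... precisely
`v ∈ rotConfig (a + b) ω ↔ ρ^a v ∈ rotConfig b ω`. [folklore] -/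
theorem mem_rotConfig_add {a b : ℕ} {ω : SiteConfig (Site 2)} {v : Site 2} :
    v ∈ rotConfig (a + b) ω ↔ triRotIsoPow a v ∈ rotConfig b ω := by
  rw [mem_rotConfig, mem_rotConfig, triRotIsoPow_add_apply]

/-- **Every site lies on side `0` of some rotated frame**: `((ρ^i)⁻¹ y)₀ = |y|_𝕋` for some `i < 6`. [folklore] -/
theorem exists_rot_symm_apply_zero_eq (y : Site 2) : ∃ i < 6, ((triRotIsoPow i).symm y) 0 = triNorm y := by
  obtain ⟨h0, h1, h2, h3, h4, h5⟩ := rot_symm_apply_formula y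
  have hn := triNorm_eq_max y
  have hcases : triNorm y = y 0 ∨ triNorm y = y 0 + y 1 ∨ triNorm y = y 1 ∨ triNorm y = -y 0 ∨
      triNorm y = -(y 0 + y 1) ∨ triNorm y = -y 1 := by
    have hle := hn.ge
    have hge := hn.le
    simp only [max_le_iff] at hle
    simp only [le_max_iff] at hge
    clear hn h0 h1 h2 h3 h4 h5
    omega
  rcases hcases with h | h | h | h | h | h
  · exact ⟨0, by norm_num, by rw [h0, h]⟩
  · exact ⟨1, by norm_num, by rw [h1, h]⟩
  · exact ⟨2, by norm_num, by rw [h2, h]⟩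
  · exact ⟨3, by norm_num, by rw [h3, h]⟩
  · exact ⟨4, by norm_num, by rw [h4, h]⟩
  · exact ⟨5, by norm_num, by rw [h5, h]⟩

/-- A site of norm `2M` with first coordinate `2M` lies on `trapO M` (`1 ≤ M`). [folklore] -/
theorem mem_trapO_of_apply_zero_eq {M : ℕ} (hM : 1 ≤ M) {y : Site 2} (hn : triNorm y = 2 * M) (h0 : y 0 = 2 * M) :
    y ∈ trapO M := by
  rw [mem_trapO_iff hM]
  rw [triNorm_eq_max] at hn
  have h' : max (max (y 0) (-y 0)) (max (max (y 1) (-y 1)) (max (y 0 + y 1) (-(y 0 + y 1)))) ≤ 2 * M := hn.le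
  simp only [max_le_iff] at h'
  omega

/-! ### Arms land on side `0` of some rotated frame -/

/-- **An arm lands on side `0` of some rotated frame.** If `ω ∈ armEvent ![b] n (2M)`
(`n ≤ 2M`, `1 ≤ M`) then for some `i < 6` the rotated configuration `rotConfig i ω` has a colour-`b`
`𝕋`-path of the annulus `{n ≤ |v| ≤ 2M}` from a site `a` of norm `n` to a site of `trapO M`
(the arm of `mem_armEvent_one_iff_exists_pathIn`, carried by `(ρ^i)⁻¹` for the `i` placing its
endpoint on side `0`). [cite: Nolin2008, §4.4 (arXiv 0711.4948: proof of Thm. 10)] -/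
theorem exists_trapO_pathIn_rotConfig {b : Bool} {n M : ℕ} (hM : 1 ≤ M) (hn : n ≤ 2 * M) {ω : SiteConfig (Site 2)}
    (h : ω ∈ armEvent ![b] n (2 * M)) :
    ∃ i < 6, ∃ a y : Site 2, triNorm a = n ∧ y ∈ trapO M ∧
      PathIn triGraph (triAnnSet n (2 * M) ∩ {v | v ∈ rotConfig i ω ↔ b}) a y := by
  obtain ⟨x, hx, y, hy, hp⟩ := (mem_armEvent_one_iff_exists_pathIn hn).1 h
  rw [mem_triSphere_iff] at hx hy
  obtain ⟨i, hi, hi0⟩ := exists_rot_symm_apply_zero_eq y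
  have hp' : PathIn triGraph (triAnnSet n (2 * M) ∩ {v | v ∈ ω ↔ b}) x y :=
    hp.mono fun v hv => ⟨⟨hv.1.1, by push_cast; exact hv.1.2⟩, hv.2⟩
  refine ⟨i, hi, (triRotIsoPow i).symm x, (triRotIsoPow i).symm y, by rw [triNorm_rot_symm, hx], ?_,
    pathIn_rotConfig i hp'⟩
  refine mem_trapO_of_apply_zero_eq hM (by rw [triNorm_rot_symm, hy]; push_cast; ring) ?_
  rw [hi0, hy]; push_cast; ring

/-- The same with the colour written as a set: for `b = true` the colour-`b` sites of `ω'` are `ω'`. [folklore] -/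
theorem setOf_mem_iff_true (ω' : SiteConfig (Site 2)) : {v : Site 2 | v ∈ ω' ↔ true} = ω' := by
  ext v; simp

/-- For `b = false` the colour-`b` sites of `ω'` are `ω'ᶜ`. [folklore] -/
theorem setOf_mem_iff_false (ω' : SiteConfig (Site 2)) : {v : Site 2 | v ∈ ω' ↔ false} = ω'ᶜ := by
  ext v; simp

end Literature.Probability.Percolation
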